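import Literature.Algebra.EuclideanLattices.RegevBranchTail
import HarnessLib

/-!
# Regev 2009, Lemma 3.14 (machine form), I: the fibres of the Gaussian register and the erased state

Topic `Algebra/EuclideanLattices` (family `pqc`), sequel of `RegevBranchState.lean` / `RegevBranchTail.lean`
on the way to the machine form of the quantum part of Regev's iterative step (the named fact
`Literature.Computability.Cryptography.regev_lwe_to_sivp_quantum`, pqc.S19). The quantum part prepares
the box Gaussian `Z⁻¹ Σ_{x ∈ Box} ρ(x)|x⟩`, computes classically and reversibly the reduction
`y(x) = x mod P(Λ)` and the coset index `s(x) ∈ ℤ_Rⁿ` of the lattice part `x − y(x) ∈ x_s + RΛ`, and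
ERASES `x` with the help of the `CVP_{L*}` oracle (Regev 2009, Lemma 3.14, proof: "Using the CVP
oracle, we can recover `x` from `x mod P(L*)`. This allows us to uncompute the first register") — an
erasure that is exact exactly on the GOOD points (one per fibre: the point whose lattice part is the
oracle's closest-vector representative, in particular every point with short lattice part). This file
is the bookkeeping of that step on the mathematical side (points of `V`, no registers):

* `QPart.fibre Λ e R Box y s` (the box points `x` with `x − y ∈ x_s + RΛ`, so that
  `branchAmp = Σ_{fibre} ρ`), `QPart.cleanAmp` (the amplitude collected at `(y, s)` by the erasure:
  the GOOD points of the fibre), the hypothesis structure `QPart.FibreHyps` (`x − y(x) ∈ x_{s(x)} + RΛ`;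
  `y(x)` only depends on `x mod Λ`; short lattice part ⇒ good; at most one good point per fibre);
* `filter_yOf_sOf_eq_fibre` — the level sets of `(y(·), s(·))` on the box ARE the fibres, hence
  `sum_filter_eq_branchAmp`; `not_good_long` — a bad point of a fibre has long lattice part;
  `abs_cleanAmp_sub_branchAmp_le` — `|clean − ψ_y(s)| ≤ τ_y(s)`;
* **`QPart.sum_normSq_bad_le`** — `Σ_{x bad} ρ(x)² ≤ Σ_{y,s} τ_y(s)²`, **`QPart.sum_cleanAmp_sq_le`** —
  `Σ_{y,s} clean(y,s)² ≤ Σ_x ρ(x)² = Z²`, **`QPart.sum_tail_sq_le`** — `Σ_{y,s} τ_y(s)² ≤ C² Σ_{y,s} ψ_y(s)²`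
  with `C = e^{2πBY} 2⁻ⁿ/κ` (from `RegevBranchTail`), and **`QPart.sqrt_sum_branchAmp_sq_le`** —
  `Z' = (Σ_{y,s} ψ_y(s)²)^{1/2} ≤ 2Z` when `C ≤ 1/2`: the erased state differs from
  `Z⁻¹ Σ_{y,s} ψ_y(s) |y, s⟩` by at most `4C` in `ℓ²` (assembled on registers in the sequel).

Everything here is proved; definitions have bodies; no named fact is introduced.

## References

* O. Regev, *On lattices, learning with errors, random linear codes, and cryptography*, J. ACM 56
  (2009), art. 34, Lemma 3.12 (proof), Claim 3.13, Lemma 3.14 (proof); author's corrected version arXiv:2401.03703v1 [Regev2009].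
-/

noncomputable section

open Module Metric Complex Finset
open scoped Real InnerProductSpace ENNReal

namespace Literature.Algebra.EuclideanLattices

namespace Regev2009

namespace QPart

open Literature.Computability.QuantumComplexity Literature.Computability.QuantumComplexity.QState

variable {V : Type*} [NormedAddCommGroup V] [InnerProductSpace ℝ V]
variable {ι : Type*} [Fintype ι]
variable (Λ : Submodule ℤ V) (e : Basis ι ℤ Λ) (R : ℕ)

/-! ### Fibres, clean amplitudes, the hypotheses -/

open Classical in
/-- **The fibre of `(y, s)`**: the box points `x` with `x − y ∈ x_s + RΛ` (so `ψ_y(s) = Σ_{fibre} ρ`).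
[cite: Regev2009, Lemma 3.14 (proof)] -/
def fibre (Box : Finset V) (y : V) (s : ι → ZMod R) : Finset V :=
  Box.filter fun x => ∃ z : Λ, x - y = reprPt Λ e R s + (R : ℝ) • (z : V)

/-- `branchAmp` is the fibre sum (definitional). [folklore] -/
theorem branchAmp_eq_sum_fibre (Box : Finset V) (y : V) (s : ι → ZMod R) :
    branchAmp Λ e R Box y s = ∑ x ∈ fibre Λ e R Box y s, gaussianFunction 1 x := rfl

/-- **The clean amplitude at `(y, s)`**: the Gaussian weight of the GOOD points of the fibre (those on
which the erasure of the register is exact). [cite: Regev2009, Lemma 3.14 (proof: "uncompute the first register")] -/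
def cleanAmp (Good : V → Prop) [DecidablePred Good] (Box : Finset V) (y : V) (s : ι → ZMod R) : ℝ :=
  ∑ x ∈ (fibre Λ e R Box y s).filter Good, gaussianFunction 1 x

/-- **The hypotheses on the classical data of the quantum part**: the reduction `y(x)` and the coset
index `s(x)` of every box point (`x − y(x) ∈ x_{s(x)} + RΛ`), `y(·)` constant on `Λ`-cosets met by the
box, every point with short lattice part good, and at most one good point per fibre.
[cite: Regev2009, Lemma 3.12 (proof: "x mod P(L)"), Lemma 3.14 (proof)] -/
structure FibreHyps (Box : Finset V) (yOf : V → V) (sOf : V → ι → ZMod R) (Good : V → Prop) : Prop where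
  /-- the lattice part of `x` lies in the coset `x_{s(x)} + RΛ` -/
  coset : ∀ x ∈ Box, ∃ z : Λ, x - yOf x = reprPt Λ e R (sOf x) + (R : ℝ) • (z : V)
  /-- `y(x)` only depends on the `Λ`-coset of `x` -/
  yuniq : ∀ x ∈ Box, ∀ x' ∈ Box, x - yOf x' ∈ Λ → yOf x = yOf x'
  /-- a short lattice part makes the point good -/
  good_short : ∀ x ∈ Box, ‖x - yOf x‖ < Real.sqrt (finrank ℝ V) → Good x
  /-- at most one good point per fibre -/
  good_inj : ∀ x ∈ Box, ∀ x' ∈ Box, Good x → Good x' → yOf x = yOf x' → sOf x = sOf x' → x = x'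

/-! ### Coset representatives are unique -/

/-- **`x_s + Rz = x_{s'} + Rz'` forces `s = s'`** (the representatives form a transversal of `Λ/RΛ`).
[cite: Regev2009, Lemma 3.14 (proof: the identification of the register with `L*/R ∩ P(L*)`)] -/
theorem eq_of_reprPt_add_smul_eq [DecidableEq ι] [NeZero R] {s s' : ι → ZMod R} {z z' : Λ}
    (h : reprPt Λ e R s + (R : ℝ) • (z : V) = reprPt Λ e R s' + (R : ℝ) • (z' : V)) : s = s' := by
  have hT := isTransversal_reprSet Λ e R
  set t : V := reprPt Λ e R s + (R : ℝ) • (z : V) with ht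
  have htΛ : t ∈ Λ := Λ.add_mem (reprPt_mem Λ e R s) (by rw [Nat.cast_smul_eq_nsmul]; exact nsmul_mem z.2 R)
  obtain ⟨x, -, huniq⟩ := hT.unique t htΛ
  have h1 : reprPt Λ e R s = x := huniq _ ⟨(mem_reprSet Λ e).2 ⟨s, rfl⟩, by
    rw [ht, add_sub_cancel_left]; exact smul_coe_mem_scaledLattice Λ R z⟩
  have h2 : reprPt Λ e R s' = x := huniq _ ⟨(mem_reprSet Λ e).2 ⟨s', rfl⟩, by
    rw [h, add_sub_cancel_left]; exact smul_coe_mem_scaledLattice Λ R z'⟩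
  exact reprPt_injective Λ e R (h1.trans h2.symm)

/-! ### The level sets of `(y(·), s(·))` are the fibres -/

variable {Λ e R}
variable {Box : Finset V} {yOf : V → V} {sOf : V → ι → ZMod R} {Good : V → Prop}

/-- A fibre point of the branch of `x₀` has reduction `y(x₀)` and the fibre's coset index. [folklore] -/
theorem yOf_sOf_of_mem_fibre [DecidableEq ι] [NeZero R] (hH : FibreHyps Λ e R Box yOf sOf Good) {x₀ : V} (hx₀ : x₀ ∈ Box)
    {s : ι → ZMod R} {x : V} (hx : x ∈ fibre Λ e R Box (yOf x₀) s) : x ∈ Box ∧ yOf x = yOf x₀ ∧ sOf x = s := by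
  classical
  unfold fibre at hx
  rw [mem_filter] at hx
  obtain ⟨hxB, z, hz⟩ := hx
  have hmem : x - yOf x₀ ∈ Λ := by
    rw [hz]; exact Λ.add_mem (reprPt_mem Λ e R s) (by rw [Nat.cast_smul_eq_nsmul]; exact nsmul_mem z.2 R)
  have hy : yOf x = yOf x₀ := hH.yuniq x hxB x₀ hx₀ hmem
  obtain ⟨z', hz'⟩ := hH.coset x hxB
  rw [hy, hz] at hz'
  exact ⟨hxB, hy, (eq_of_reprPt_add_smul_eq Λ e R hz').symm⟩

/-- **The level set of `(y(·), s(·))` at `(y(x₀), s)` is the fibre.** [cite: Regev2009, Lemma 3.14 (proof)] -/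
theorem filter_yOf_sOf_eq_fibre [DecidableEq ι] [NeZero R] [DecidableEq V] (hH : FibreHyps Λ e R Box yOf sOf Good)
    {x₀ : V} (hx₀ : x₀ ∈ Box) (s : ι → ZMod R) :
    Box.filter (fun x => yOf x = yOf x₀ ∧ sOf x = s) = fibre Λ e R Box (yOf x₀) s := by
  classical
  ext x
  constructor
  · intro hx
    rw [mem_filter] at hx
    obtain ⟨hxB, hy, hs⟩ := hx
    unfold fibre
    rw [mem_filter]
    obtain ⟨z, hz⟩ := hH.coset x hxB
    exact ⟨hxB, z, by rw [← hy, ← hs, hz]⟩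
  · intro hx
    obtain ⟨hxB, hy, hs⟩ := yOf_sOf_of_mem_fibre hH hx₀ hx
    exact mem_filter.2 ⟨hxB, hy, hs⟩

/-- **The branch amplitude is the Gaussian weight of the level set.** [cite: Regev2009, Lemma 3.12 (proof)] -/
theorem sum_filter_eq_branchAmp [DecidableEq ι] [NeZero R] [DecidableEq V] (hH : FibreHyps Λ e R Box yOf sOf Good)
    {x₀ : V} (hx₀ : x₀ ∈ Box) (s : ι → ZMod R) :
    ∑ x ∈ Box.filter (fun x => yOf x = yOf x₀ ∧ sOf x = s), gaussianFunction 1 x = branchAmp Λ e R Box (yOf x₀) s := by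
  rw [filter_yOf_sOf_eq_fibre hH hx₀]; rfl

/-- **A bad point of a fibre has long lattice part** (short lattice part would make it good).
[cite: Regev2009, Lemma 3.14 (proof)] -/
theorem not_good_long [DecidableEq ι] [NeZero R] (hH : FibreHyps Λ e R Box yOf sOf Good) {x₀ : V} (hx₀ : x₀ ∈ Box)
    {s : ι → ZMod R} {x : V} (hx : x ∈ fibre Λ e R Box (yOf x₀) s) (hbad : ¬ Good x) :
    Real.sqrt (finrank ℝ V) ≤ ‖x - yOf x₀‖ := by
  obtain ⟨hxB, hy, -⟩ := yOf_sOf_of_mem_fibre hH hx₀ hx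
  refine le_of_not_gt fun hlt => hbad (hH.good_short x hxB ?_)
  rwa [hy]

/-- **The good points of a fibre are at most one.** [cite: Regev2009, Lemma 3.14 (proof: the closest vector is a function of the query)] -/
theorem card_filter_good_le_one [DecidableEq ι] [NeZero R] [DecidablePred Good] (hH : FibreHyps Λ e R Box yOf sOf Good)
    {x₀ : V} (hx₀ : x₀ ∈ Box) (s : ι → ZMod R) : ((fibre Λ e R Box (yOf x₀) s).filter Good).card ≤ 1 := by
  rw [Finset.card_le_one]
  intro a ha b hb
  rw [mem_filter] at ha hb
  obtain ⟨haB, hya, hsa⟩ := yOf_sOf_of_mem_fibre hH hx₀ ha.1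
  obtain ⟨hbB, hyb, hsb⟩ := yOf_sOf_of_mem_fibre hH hx₀ hb.1
  exact hH.good_inj a haB b hbB ha.2 hb.2 (hya.trans hyb.symm) (hsa.trans hsb.symm)

/-- **`|clean(y,s) − ψ_y(s)| ≤ τ_y(s)`** on every branch of the box. [cite: Regev2009, Lemma 3.14 (proof)] -/
theorem abs_cleanAmp_sub_branchAmp_le [DecidableEq ι] [NeZero R] [DecidablePred Good] (hH : FibreHyps Λ e R Box yOf sOf Good)
    {x₀ : V} (hx₀ : x₀ ∈ Box) (s : ι → ZMod R) :
    |cleanAmp Λ e R Good Box (yOf x₀) s - branchAmp Λ e R Box (yOf x₀) s| ≤ tailBranchAmp Λ e R Box (yOf x₀) s := by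
  classical
  unfold cleanAmp
  refine abs_sum_sub_branchAmp_le Λ e R (filter_subset _ _) fun x hxB hz hlt => ?_
  have hx : x ∈ fibre Λ e R Box (yOf x₀) s := by unfold fibre; exact mem_filter.2 ⟨hxB, hz⟩
  obtain ⟨-, hy, -⟩ := yOf_sOf_of_mem_fibre hH hx₀ hx
  exact mem_filter.2 ⟨hx, hH.good_short x hxB (by rwa [hy])⟩

/-! ### The three mass estimates -/

/-- **The bad points carry at most the tails**: `Σ_{x ∈ Box, bad} ρ(x)² ≤ Σ_{y ∈ y(Box)} Σ_s τ_y(s)²`.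
[cite: Regev2009, Lemma 3.14 (proof), Claim 3.13] -/
theorem sum_normSq_bad_le [DecidableEq ι] [NeZero R] [DecidableEq V] [DecidablePred Good] (hH : FibreHyps Λ e R Box yOf sOf Good) :
    ∑ x ∈ Box.filter (fun x => ¬ Good x), gaussianFunction 1 x ^ 2 ≤
      ∑ y ∈ Box.image yOf, ∑ s : ι → ZMod R, tailBranchAmp Λ e R Box y s ^ 2 := by
  classical
  -- regroup the bad points by their fibre
  have hmaps : ∀ x ∈ Box.filter (fun x => ¬ Good x), (yOf x, sOf x) ∈ (Box.image yOf) ×ˢ (univ : Finset (ι → ZMod R)) :=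
    fun x hx => mem_product.2 ⟨mem_image_of_mem _ (mem_filter.1 hx).1, mem_univ _⟩
  rw [← sum_fiberwise_of_maps_to hmaps, sum_product]
  refine sum_le_sum fun y hy => sum_le_sum fun s _ => ?_
  obtain ⟨x₀, hx₀, rfl⟩ := mem_image.1 hy
  -- the bad part of the fibre
  have hset : (Box.filter (fun x => ¬ Good x)).filter (fun x => (yOf x, sOf x) = (yOf x₀, s)) =
      (fibre Λ e R Box (yOf x₀) s).filter (fun x => ¬ Good x) := by
    rw [filter_filter, ← filter_yOf_sOf_eq_fibre hH hx₀ s, filter_filter]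
    refine filter_congr fun x _ => ?_
    simp only [Prod.mk.injEq]
    tauto
  rw [hset]
  calc ∑ x ∈ (fibre Λ e R Box (yOf x₀) s).filter (fun x => ¬ Good x), gaussianFunction 1 x ^ 2
      ≤ (∑ x ∈ (fibre Λ e R Box (yOf x₀) s).filter (fun x => ¬ Good x), gaussianFunction 1 x) ^ 2 :=
        sum_sq_le_sq_sum_of_nonneg fun _ _ => (gaussianFunction_pos _ _).le
    _ ≤ tailBranchAmp Λ e R Box (yOf x₀) s ^ 2 := by
        refine pow_le_pow_left₀ (sum_nonneg fun _ _ => (gaussianFunction_pos _ _).le) ?_ 2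
        unfold tailBranchAmp
        refine sum_le_sum_of_subset_of_nonneg (fun x hx => ?_) (fun _ _ _ => (gaussianFunction_pos _ _).le)
        rw [mem_filter] at hx
        have hlong := not_good_long hH hx₀ hx.1 hx.2
        have hx1 := hx.1
        unfold fibre at hx1
        rw [mem_filter] at hx1
        exact mem_filter.2 ⟨hx1.1, hx1.2, hlong⟩

/-- On a set of at most one element, the square of the sum is the sum of the squares. [folklore] -/
theorem sq_sum_eq_sum_sq_of_card_le_one {α : Type*} {t : Finset α} (ht : t.card ≤ 1) (f : α → ℝ) :
    (∑ x ∈ t, f x) ^ 2 = ∑ x ∈ t, f x ^ 2 := by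
  rcases t.eq_empty_or_nonempty with rfl | ⟨a, ha⟩
  · simp
  · have h := Finset.card_le_one.1 ht
    have hta : t = {a} := Finset.eq_singleton_iff_unique_mem.2 ⟨ha, fun b hb => h b hb a ha⟩
    rw [hta, sum_singleton, sum_singleton]

/-- **The clean amplitudes carry at most `Z²`**: `Σ_{y ∈ y(Box)} Σ_s clean(y,s)² ≤ Σ_{x ∈ Box} ρ(x)²` (one good
point per fibre). [cite: Regev2009, Lemma 3.14 (proof)] -/
theorem sum_cleanAmp_sq_le [DecidableEq ι] [NeZero R] [DecidableEq V] [DecidablePred Good] (hH : FibreHyps Λ e R Box yOf sOf Good) :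
    ∑ y ∈ Box.image yOf, ∑ s : ι → ZMod R, cleanAmp Λ e R Good Box y s ^ 2 ≤ ∑ x ∈ Box, gaussianFunction 1 x ^ 2 := by
  classical
  have hmaps : ∀ x ∈ Box.filter Good, (yOf x, sOf x) ∈ (Box.image yOf) ×ˢ (univ : Finset (ι → ZMod R)) :=
    fun x hx => mem_product.2 ⟨mem_image_of_mem _ (mem_filter.1 hx).1, mem_univ _⟩
  calc ∑ y ∈ Box.image yOf, ∑ s : ι → ZMod R, cleanAmp Λ e R Good Box y s ^ 2
      = ∑ y ∈ Box.image yOf, ∑ s : ι → ZMod R, ∑ x ∈ (fibre Λ e R Box y s).filter Good, gaussianFunction 1 x ^ 2 := by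
        refine sum_congr rfl fun y hy => sum_congr rfl fun s _ => ?_
        obtain ⟨x₀, hx₀, rfl⟩ := mem_image.1 hy
        exact sq_sum_eq_sum_sq_of_card_le_one (card_filter_good_le_one hH hx₀ s) _
    _ = ∑ x ∈ Box.filter Good, gaussianFunction 1 x ^ 2 := by
        rw [← sum_fiberwise_of_maps_to hmaps, sum_product]
        refine sum_congr rfl fun y hy => sum_congr rfl fun s _ => ?_
        obtain ⟨x₀, hx₀, rfl⟩ := mem_image.1 hy
        congr 1
        rw [filter_filter, ← filter_yOf_sOf_eq_fibre hH hx₀ s, filter_filter]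
        refine filter_congr fun x _ => ?_
        simp only [Prod.mk.injEq]
        tauto
    _ ≤ ∑ x ∈ Box, gaussianFunction 1 x ^ 2 :=
        sum_le_sum_of_subset_of_nonneg (filter_subset _ _) fun _ _ _ => sq_nonneg _

/-- **The tails are relatively small, branch by branch**: under the hypotheses of `RegevBranchState` for
every branch of the box, `Σ_{y ∈ y(Box)} Σ_s τ_y(s)² ≤ (e^{4πBY} 4⁻ⁿ/κ²) Σ_{y ∈ y(Box)} Σ_s ψ_y(s)²`,
`κ = (1−δ)(1−b₁ⁿ)(1−4⁻ⁿ)`. [cite: Regev2009, Lemma 3.12 (proof), Claim 3.13] -/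
theorem sum_tail_sq_le [FiniteDimensional ℝ V] [MeasurableSpace V] [BorelSpace V] [DiscreteTopology Λ] [IsZLattice ℝ Λ]
    [DecidableEq ι] [NeZero R] [DecidableEq V] {B Y : ℝ}
    (hsvΛ : ∀ z ∈ scaledLattice Λ R, ‖z‖ < 2 * Real.sqrt (finrank ℝ V) → z = 0)
    (hBox : ∀ x ∈ Box, BoxCoversShort Λ Box (yOf x)) (hY : ∀ x ∈ Box, ‖yOf x‖ ≤ Y)
    (hB : ∀ x ∈ Box, ∀ x' ∈ Box, ‖x - yOf x'‖ ≤ B)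
    (hδ : π * (2 * Real.sqrt (finrank ℝ V) * Y + Y ^ 2) < 1) :
    ((1 - π * (2 * Real.sqrt (finrank ℝ V) * Y + Y ^ 2)) * (1 - banaConst ^ finrank ℝ V) * (1 - (4⁻¹ : ℝ) ^ finrank ℝ V)) ^ 2 *
        ∑ y ∈ Box.image yOf, ∑ s : ι → ZMod R, tailBranchAmp Λ e R Box y s ^ 2 ≤
      Real.exp (4 * π * B * Y) * (4⁻¹ : ℝ) ^ finrank ℝ V *
        ∑ y ∈ Box.image yOf, ∑ s : ι → ZMod R, branchAmp Λ e R Box y s ^ 2 := by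
  set κ : ℝ := (1 - π * (2 * Real.sqrt (finrank ℝ V) * Y + Y ^ 2)) * (1 - banaConst ^ finrank ℝ V) *
    (1 - (4⁻¹ : ℝ) ^ finrank ℝ V) with hκ
  rw [mul_sum, mul_sum]
  refine sum_le_sum fun y hy => ?_
  obtain ⟨x₀, hx₀, rfl⟩ := mem_image.1 hy
  have h1 := sum_tailBranchAmp_sq_le Λ e R (fun x hx => hB x hx x₀ hx₀) (hY x₀ hx₀)
  have h2 := sq_mul_sum_periodicAmp_sq_le Λ e R hsvΛ (hBox x₀ hx₀) (hY x₀ hx₀) hδ.le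
  rw [← hκ] at h2
  have hE : 0 ≤ Real.exp (4 * π * B * Y) * (4⁻¹ : ℝ) ^ finrank ℝ V := by positivity
  calc κ ^ 2 * ∑ s : ι → ZMod R, tailBranchAmp Λ e R Box (yOf x₀) s ^ 2
      ≤ κ ^ 2 * (Real.exp (4 * π * B * Y) * (4⁻¹ : ℝ) ^ finrank ℝ V * ∑ s : ι → ZMod R, periodicAmp Λ e R s ^ 2) :=
        mul_le_mul_of_nonneg_left h1 (sq_nonneg _)
    _ = Real.exp (4 * π * B * Y) * (4⁻¹ : ℝ) ^ finrank ℝ V * (κ ^ 2 * ∑ s : ι → ZMod R, periodicAmp Λ e R s ^ 2) := by ring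
    _ ≤ Real.exp (4 * π * B * Y) * (4⁻¹ : ℝ) ^ finrank ℝ V * ∑ s : ι → ZMod R, branchAmp Λ e R Box (yOf x₀) s ^ 2 :=
        mul_le_mul_of_nonneg_left h2 hE

/-- **The clean-plus-tail decomposition bounds the branch norm by the box norm**:
`√(Σ_{y,s} ψ_y(s)²) ≤ √(Σ_x ρ(x)²) + √(Σ_{y,s} τ_y(s)²)` (`ψ ≤ clean + τ` termwise, one good point per
fibre, Minkowski). [cite: Regev2009, Lemma 3.14 (proof)] -/
theorem sqrt_sum_branchAmp_sq_le_add [DecidableEq ι] [NeZero R] [DecidableEq V] [DecidablePred Good]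
    (hH : FibreHyps Λ e R Box yOf sOf Good) :
    Real.sqrt (∑ y ∈ Box.image yOf, ∑ s : ι → ZMod R, branchAmp Λ e R Box y s ^ 2) ≤
      Real.sqrt (∑ x ∈ Box, gaussianFunction 1 x ^ 2) +
        Real.sqrt (∑ y ∈ Box.image yOf, ∑ s : ι → ZMod R, tailBranchAmp Λ e R Box y s ^ 2) := by
  classical
  -- termwise `0 ≤ ψ ≤ clean + τ`
  have hterm : ∀ y ∈ Box.image yOf, ∀ s : ι → ZMod R,
      branchAmp Λ e R Box y s ≤ cleanAmp Λ e R Good Box y s + tailBranchAmp Λ e R Box y s := by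
    intro y hy s
    obtain ⟨x₀, hx₀, rfl⟩ := mem_image.1 hy
    have h := abs_cleanAmp_sub_branchAmp_le (Good := Good) hH hx₀ s
    rw [abs_le] at h
    linarith [h.1]
  -- Minkowski on the index set `y(Box) × ℤ_Rⁿ`, via the Euclidean norm of `ℝ^{…}`
  set I := (Box.image yOf) ×ˢ (univ : Finset (ι → ZMod R)) with hI
  have key : ∀ (f g : V × (ι → ZMod R) → ℝ), (∀ p ∈ I, 0 ≤ f p) → (∀ p ∈ I, 0 ≤ g p) →
      Real.sqrt (∑ p ∈ I, (f p + g p) ^ 2) ≤ Real.sqrt (∑ p ∈ I, f p ^ 2) + Real.sqrt (∑ p ∈ I, g p ^ 2) := by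
    intro f g hf hg
    -- square both sides
    have hA : 0 ≤ Real.sqrt (∑ p ∈ I, f p ^ 2) + Real.sqrt (∑ p ∈ I, g p ^ 2) := by positivity
    rw [Real.sqrt_le_left hA] at *
    have hCS : ∑ p ∈ I, f p * g p ≤ Real.sqrt (∑ p ∈ I, f p ^ 2) * Real.sqrt (∑ p ∈ I, g p ^ 2) := by
      rw [← Real.sqrt_mul (sum_nonneg fun _ _ => sq_nonneg _)]
      exact Real.le_sqrt_of_sq_le (Finset.sum_mul_sq_le_sq_mul_sq I f g)
    have hf2 : Real.sqrt (∑ p ∈ I, f p ^ 2) ^ 2 = ∑ p ∈ I, f p ^ 2 := Real.sq_sqrt (sum_nonneg fun _ _ => sq_nonneg _)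
    have hg2 : Real.sqrt (∑ p ∈ I, g p ^ 2) ^ 2 = ∑ p ∈ I, g p ^ 2 := Real.sq_sqrt (sum_nonneg fun _ _ => sq_nonneg _)
    calc ∑ p ∈ I, (f p + g p) ^ 2 = ∑ p ∈ I, f p ^ 2 + 2 * ∑ p ∈ I, f p * g p + ∑ p ∈ I, g p ^ 2 := by
          rw [mul_sum, ← sum_add_distrib, ← sum_add_distrib]; exact sum_congr rfl fun p _ => by ring
      _ ≤ (Real.sqrt (∑ p ∈ I, f p ^ 2) + Real.sqrt (∑ p ∈ I, g p ^ 2)) ^ 2 := by nlinarith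
  -- apply with `f = clean ⊕ (x ↦ ρ restricted)`… concretely: `ψ ≤ clean + τ` termwise, then monotonicity of `√Σ(·)²`
  have hmono : Real.sqrt (∑ y ∈ Box.image yOf, ∑ s : ι → ZMod R, branchAmp Λ e R Box y s ^ 2) ≤
      Real.sqrt (∑ p ∈ I, (cleanAmp Λ e R Good Box p.1 p.2 + tailBranchAmp Λ e R Box p.1 p.2) ^ 2) := by
    refine Real.sqrt_le_sqrt ?_
    rw [hI, sum_product]
    refine sum_le_sum fun y hy => sum_le_sum fun s _ => ?_
    exact pow_le_pow_left₀ (branchAmp_nonneg Λ e R Box y s) (hterm y hy s) 2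
  refine hmono.trans ((key _ _ (fun p _ => sum_nonneg fun _ _ => (gaussianFunction_pos _ _).le)
    (fun p _ => tailBranchAmp_nonneg Λ e R Box p.1 p.2)).trans (add_le_add ?_ (le_of_eq ?_)))
  · refine Real.sqrt_le_sqrt ?_
    rw [hI, sum_product]
    exact sum_cleanAmp_sq_le hH
  · rw [hI, sum_product]

end QPart

end Regev2009

end Literature.Algebra.EuclideanLattices
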